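import Mathlib
import Literature.NumberTheory.Transcendental.ZagierDilogarithmConjecture
import HarnessLib

/-!
# Biquadratic points with signs: `τ`-monomial families over `ℚ(√e, √−d)` stay monomial under
# every `ℚ`-embedding

Stub `stub_biquadraticSigned` of the line `kummer-clausen-linearisation` (reshape c2,
"Galois descent") for the crux `ZagierDilogarithmConjecture` (stmt-KontsevichZagierPeriods-10550,
route `HyperbolicBloch`).

Write `ℚ̄ := algebraicClosure ℚ ℂ ⊆ ℂ`. For a combination `β = Σ nᵢ[zᵢ]` of algebraic points, a
family `u : Fin k → ℂ` is *monomial over `β`* if there are `e ∈ ℤ` and a permutation `π` of the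
indices such that for every `i` one of the following holds: `uᵢ` is real and `e·n_{πi} = 0`;
`uᵢ = z_{πi}` and `nᵢ = e·n_{πi}`; `uᵢ = z̄_{πi}` and `nᵢ = −e·n_{πi}`. The sibling stub
`stub_monomialSymmetric` turns monomiality of the two families `(σwᵢ)ᵢ`, `(σw'ᵢ)ᵢ` (for every
`ℚ`-embedding `σ : ℚ̄ → ℂ` and lifts `wᵢ, w'ᵢ ∈ ℚ̄` of `zᵢ, z̄ᵢ`) into self-similarity of `β`.

**This file** (`stub_biquadraticSigned`): let `s = √e`, `t = √d·i` (`d, e ∈ ℕ`) and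
`zᵢ = aᵢ + bᵢ s + (cᵢ + fᵢ s) t` with `aᵢ, bᵢ, cᵢ, fᵢ ∈ ℚ`; let `τ : s ↦ −s`, so
`τzᵢ = aᵢ − bᵢ s + (cᵢ − fᵢ s) t`. If the family `(τzᵢ)ᵢ` is monomial over `β` through the second
and third alternatives (data `E, π`), then for every `σ` both `(σwᵢ)ᵢ` and `(σw'ᵢ)ᵢ` are monomial.

Proof: lift `s, t` to `S, T ∈ ℚ̄`; then `(σS)² = e = s²`, `(σT)² = −d = t²`, so `σS = ±s`,
`σT = ±t`, and in `ℚ̄` the lifts read `wᵢ = aᵢ + bᵢS + (cᵢ + fᵢS)T`, `w'ᵢ = aᵢ + bᵢS − (cᵢ + fᵢS)T`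
(`s̄ = s`, `t̄ = −t`). Hence `(σwᵢ, σw'ᵢ)` is `(zᵢ, z̄ᵢ)`, `(z̄ᵢ, zᵢ)`, `(τzᵢ, conj τzᵢ)` or
`(conj τzᵢ, τzᵢ)` according to the four sign patterns. The family `z` is monomial with data
`(1, 1)`, the family `τz` with the given `(E, π)`, and conjugating a family that is monomial through
the last two alternatives swaps them and negates `E` (`biqSigned_conj`).

Sources: Zagier 2007 Ch. I §§3–4 (the conjecture and its Galois bookkeeping); the computation is
elementary Galois theory of the biquadratic field `ℚ(√e, √−d)` [folklore].
Not here: the passage from monomial families to self-similarity (`stub_monomialSymmetric`) and the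
unsigned `τ`-symmetric case (`stub_biquadraticSymmetric`) — separate stubs of the line.
-/

noncomputable section

open scoped BigOperators ComplexConjugate
open Literature.NumberTheory.Transcendental

namespace Summit.KontsevichZagierPeriods.HyperbolicBloch.ZagierDilogarithmGaloisDescent

/-- The family `z` itself is monomial over `Σ nᵢ[zᵢ]` through the second alternative, with data
`(E, π) = (1, 1)`. [folklore] -/
theorem biqSigned_self {k : ℕ} (z : Fin k → ℂ) (n : Fin k → ℤ) :
    ∃ (E : ℤ) (π : Equiv.Perm (Fin k)), ∀ i,
      (z i = z (π i) ∧ n i = E * n (π i)) ∨ (z i = conj (z (π i)) ∧ n i = -(E * n (π i))) :=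
  ⟨1, Equiv.refl _, fun _ => Or.inl ⟨rfl, (one_mul _).symm⟩⟩

/-- Conjugating a family that is monomial over `Σ nᵢ[zᵢ]` through the last two alternatives swaps
the two alternatives and negates `E`. [folklore] -/
theorem biqSigned_conj {k : ℕ} (z u : Fin k → ℂ) (n : Fin k → ℤ)
    (h : ∃ (E : ℤ) (π : Equiv.Perm (Fin k)), ∀ i,
      (u i = z (π i) ∧ n i = E * n (π i)) ∨ (u i = conj (z (π i)) ∧ n i = -(E * n (π i)))) :
    ∃ (E : ℤ) (π : Equiv.Perm (Fin k)), ∀ i,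
      (conj (u i) = z (π i) ∧ n i = E * n (π i)) ∨
        (conj (u i) = conj (z (π i)) ∧ n i = -(E * n (π i))) := by
  obtain ⟨E, π, h⟩ := h
  refine ⟨-E, π, fun i => ?_⟩
  rcases h i with ⟨h1, h2⟩ | ⟨h1, h2⟩
  · exact Or.inr ⟨by rw [h1], by rw [h2, neg_mul, neg_neg]⟩
  · exact Or.inl ⟨by rw [h1, Complex.conj_conj], by rw [h2, neg_mul]⟩

/-- Transport along a pointwise equality `u = v`: if `v` is monomial over `Σ nᵢ[zᵢ]` through the
last two alternatives, then `u` is monomial (three alternatives). [folklore] -/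
theorem biqSigned_of_eq {k : ℕ} (z u v : Fin k → ℂ) (n : Fin k → ℤ) (huv : ∀ i, u i = v i)
    (h : ∃ (E : ℤ) (π : Equiv.Perm (Fin k)), ∀ i,
      (v i = z (π i) ∧ n i = E * n (π i)) ∨ (v i = conj (z (π i)) ∧ n i = -(E * n (π i)))) :
    ∃ (e : ℤ) (π : Equiv.Perm (Fin k)), ∀ i,
      ((u i).im = 0 ∧ e * n (π i) = 0) ∨ (u i = z (π i) ∧ n i = e * n (π i)) ∨
        (u i = conj (z (π i)) ∧ n i = -(e * n (π i))) := by
  obtain ⟨E, π, h⟩ := h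
  refine ⟨E, π, fun i => Or.inr ?_⟩
  rw [huv i]
  exact h i

/-- **Biquadratic points with signs.** Points `zᵢ = aᵢ + bᵢ√e + (cᵢ + fᵢ√e)·√d·i` of `ℚ(√e, √−d)`
(`aᵢ, bᵢ, cᵢ, fᵢ ∈ ℚ`, `d, e ∈ ℕ`); `τ : √e ↦ −√e`. If the family `(τzᵢ)ᵢ` is monomial over
`Σ nᵢ[zᵢ]` through the second and third alternatives (some `E, π` with `τzᵢ = z_{πi}, nᵢ = E n_{πi}`
or `τzᵢ = z̄_{πi}, nᵢ = −E n_{πi}` for each `i`), then for every `ℚ`-embedding `σ : ℚ̄ → ℂ` and all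
lifts `wᵢ, w'ᵢ ∈ ℚ̄` of `zᵢ, z̄ᵢ` both families `(σwᵢ)ᵢ` and `(σw'ᵢ)ᵢ` are monomial: `σ(√e) = ±√e`,
`σ(√d·i) = ±√d·i`, so `(σwᵢ, σw'ᵢ) ∈ {(zᵢ, z̄ᵢ), (z̄ᵢ, zᵢ), (τzᵢ, conj τzᵢ), (conj τzᵢ, τzᵢ)}`
with data `(1, 1)`, `(−1, 1)`, `(E, π)`, `(−E, π)` respectively. [folklore] -/
theorem stub_biquadraticSigned :
    ∀ (d e : ℕ) (k : ℕ) (z : Fin k → ℂ) (n : Fin k → ℤ) (a b c f : Fin k → ℚ),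
      (∀ i, z i = a i + b i * (Real.sqrt e : ℂ) +
        (c i + f i * (Real.sqrt e : ℂ)) * ((Real.sqrt d : ℂ) * Complex.I)) →
      (∃ (E : ℤ) (π : Equiv.Perm (Fin k)), ∀ i,
          ((a i : ℂ) - b i * (Real.sqrt e : ℂ) +
              (c i - f i * (Real.sqrt e : ℂ)) * ((Real.sqrt d : ℂ) * Complex.I) = z (π i) ∧
            n i = E * n (π i)) ∨
          ((a i : ℂ) - b i * (Real.sqrt e : ℂ) +
              (c i - f i * (Real.sqrt e : ℂ)) * ((Real.sqrt d : ℂ) * Complex.I) = conj (z (π i)) ∧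
            n i = -(E * n (π i)))) →
        ∀ (σ : ↥(algebraicClosure ℚ ℂ) →ₐ[ℚ] ℂ) (w w' : Fin k → ↥(algebraicClosure ℚ ℂ)),
          (∀ i, (w i : ℂ) = z i) → (∀ i, (w' i : ℂ) = conj (z i)) →
          (∃ (e : ℤ) (π : Equiv.Perm (Fin k)), ∀ i,
              ((σ (w i)).im = 0 ∧ e * n (π i) = 0) ∨ (σ (w i) = z (π i) ∧ n i = e * n (π i)) ∨
                (σ (w i) = conj (z (π i)) ∧ n i = -(e * n (π i)))) ∧
          (∃ (e : ℤ) (π : Equiv.Perm (Fin k)), ∀ i,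
              ((σ (w' i)).im = 0 ∧ e * n (π i) = 0) ∨ (σ (w' i) = z (π i) ∧ n i = e * n (π i)) ∨
                (σ (w' i) = conj (z (π i)) ∧ n i = -(e * n (π i)))) := by
  intro d e k z n a b c f hz hτ σ w w' hw hw'
  -- `s = √e`, `t = √d·i`: `s² = e`, `t² = −d`, `s̄ = s`, `t̄ = −t`, both algebraic
  set s : ℂ := (Real.sqrt e : ℂ) with hs
  set t : ℂ := (Real.sqrt d : ℂ) * Complex.I with ht
  have hs2 : s ^ 2 = (e : ℂ) := by
    rw [hs, ← Complex.ofReal_pow, Real.sq_sqrt (Nat.cast_nonneg _), Complex.ofReal_natCast]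
  have ht2 : t ^ 2 = -(d : ℂ) := by
    rw [ht, mul_pow, Complex.I_sq, ← Complex.ofReal_pow, Real.sq_sqrt (Nat.cast_nonneg _),
      Complex.ofReal_natCast, mul_neg_one]
  have hsc : conj s = s := by rw [hs, Complex.conj_ofReal]
  have htc : conj t = -t := by rw [ht, map_mul, Complex.conj_ofReal, Complex.conj_I, mul_neg]
  have hsa : IsAlgebraic ℚ s := by
    refine ⟨Polynomial.X ^ 2 - Polynomial.C (e : ℚ),
      Polynomial.X_pow_sub_C_ne_zero (by norm_num) _, ?_⟩
    simp [hs2]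
  have hta : IsAlgebraic ℚ t := by
    refine ⟨Polynomial.X ^ 2 + Polynomial.C (d : ℚ),
      Polynomial.X_pow_add_C_ne_zero (by norm_num) _, ?_⟩
    simp [ht2]
  have hz' : ∀ i, conj (z i) = a i + b i * s - (c i + f i * s) * t := fun i => by
    rw [hz i]
    simp only [map_add, map_mul, hsc, htc, map_ratCast]
    ring
  -- the `τ`-family `yᵢ = τzᵢ = aᵢ − bᵢ s + (cᵢ − fᵢ s) t` and its conjugate
  set y : Fin k → ℂ := fun i => a i - b i * s + (c i - f i * s) * t with hy
  have hy' : ∀ i, conj (y i) = a i - b i * s - (c i - f i * s) * t := fun i => by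
    simp only [hy, map_add, map_sub, map_mul, hsc, htc, map_ratCast]
    ring
  have hτ' : ∃ (E : ℤ) (π : Equiv.Perm (Fin k)), ∀ i,
      (y i = z (π i) ∧ n i = E * n (π i)) ∨ (y i = conj (z (π i)) ∧ n i = -(E * n (π i))) := hτ
  -- lifts `S, T ∈ ℚ̄` of `s, t`; `σ S = ± s`, `σ T = ± t`
  obtain ⟨S, hS⟩ : ∃ S : ↥(algebraicClosure ℚ ℂ), (S : ℂ) = s :=
    ⟨⟨s, mem_algebraicClosure_iff.2 hsa⟩, rfl⟩
  obtain ⟨T, hT⟩ : ∃ T : ↥(algebraicClosure ℚ ℂ), (T : ℂ) = t :=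
    ⟨⟨t, mem_algebraicClosure_iff.2 hta⟩, rfl⟩
  have hσS : σ S = s ∨ σ S = -s := by
    refine sq_eq_sq_iff_eq_or_eq_neg.1 ?_
    have e' : S ^ 2 = ((e : ℚ) : ↥(algebraicClosure ℚ ℂ)) := Subtype.ext (by
      push_cast
      rw [hS, hs2])
    rw [← map_pow, e', map_ratCast, Rat.cast_natCast, hs2]
  have hσT : σ T = t ∨ σ T = -t := by
    refine sq_eq_sq_iff_eq_or_eq_neg.1 ?_
    have e' : T ^ 2 = ((-d : ℚ) : ↥(algebraicClosure ℚ ℂ)) := Subtype.ext (by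
      push_cast
      rw [hT, ht2])
    rw [← map_pow, e', map_ratCast, Rat.cast_neg, Rat.cast_natCast, ht2]
  -- the lifts in coordinates: `wᵢ = aᵢ + bᵢS + (cᵢ + fᵢS)T`, `w'ᵢ = aᵢ + bᵢS − (cᵢ + fᵢS)T`
  have hσw : ∀ i, σ (w i) = a i + b i * σ S + (c i + f i * σ S) * σ T := fun i => by
    have e' : w i = (a i : ↥(algebraicClosure ℚ ℂ)) + (b i : ↥(algebraicClosure ℚ ℂ)) * S +
        ((c i : ↥(algebraicClosure ℚ ℂ)) + (f i : ↥(algebraicClosure ℚ ℂ)) * S) * T :=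
      Subtype.ext (by
        push_cast
        rw [hw i, hz i, hS, hT])
    simp only [e', map_add, map_mul, map_ratCast]
  have hσw' : ∀ i, σ (w' i) = a i + b i * σ S - (c i + f i * σ S) * σ T := fun i => by
    have e' : w' i = (a i : ↥(algebraicClosure ℚ ℂ)) + (b i : ↥(algebraicClosure ℚ ℂ)) * S -
        ((c i : ↥(algebraicClosure ℚ ℂ)) + (f i : ↥(algebraicClosure ℚ ℂ)) * S) * T :=
      Subtype.ext (by
        push_cast
        rw [hw' i, hz' i, hS, hT])
    simp only [e', map_add, map_sub, map_mul, map_ratCast]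
  -- the four sign cases
  rcases hσS with hS' | hS' <;> rcases hσT with hT' | hT'
  · -- `σ S = s`, `σ T = t`: `σwᵢ = zᵢ`, `σw'ᵢ = z̄ᵢ`
    refine ⟨biqSigned_of_eq z _ z n (fun i => ?_) (biqSigned_self z n),
      biqSigned_of_eq z _ _ n (fun i => ?_) (biqSigned_conj z z n (biqSigned_self z n))⟩
    · rw [hσw i, hS', hT', hz i]
    · rw [hσw' i, hS', hT', hz' i]
  · -- `σ S = s`, `σ T = −t`: `σwᵢ = z̄ᵢ`, `σw'ᵢ = zᵢ`
    refine ⟨biqSigned_of_eq z _ _ n (fun i => ?_) (biqSigned_conj z z n (biqSigned_self z n)),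
      biqSigned_of_eq z _ z n (fun i => ?_) (biqSigned_self z n)⟩
    · rw [hσw i, hS', hT', hz' i]
      ring
    · rw [hσw' i, hS', hT', hz i]
      ring
  · -- `σ S = −s`, `σ T = t`: `σwᵢ = τzᵢ`, `σw'ᵢ = conj τzᵢ`
    refine ⟨biqSigned_of_eq z _ y n (fun i => ?_) hτ',
      biqSigned_of_eq z _ _ n (fun i => ?_) (biqSigned_conj z y n hτ')⟩
    · rw [hσw i, hS', hT', hy]
      ring
    · rw [hσw' i, hS', hT', hy' i]
      ring
  · -- `σ S = −s`, `σ T = −t`: `σwᵢ = conj τzᵢ`, `σw'ᵢ = τzᵢ`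
    refine ⟨biqSigned_of_eq z _ _ n (fun i => ?_) (biqSigned_conj z y n hτ'),
      biqSigned_of_eq z _ y n (fun i => ?_) hτ'⟩
    · rw [hσw i, hS', hT', hy' i]
      ring
    · rw [hσw' i, hS', hT', hy]
      ring

end Summit.KontsevichZagierPeriods.HyperbolicBloch.ZagierDilogarithmGaloisDescent

end
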